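import Summits.ResolutionOfSingularities.ResolutionOfSingularities.Theorems.EquisingularLiftEquisingularLiftNatTowerRationalDefs
import Summits.ResolutionOfSingularities.ResolutionOfSingularities.Theorems.EquisingularLiftEquisingularLiftNatTowerOfDirZero
import HarnessLib

/-!
# Route `EquisingularLift`, crux EL♮ (stmt-ResolutionOfSingularities-20038) / EL♮(3) (stmt-…-20148) — rung DIR₀, RATIONAL-CARRIER re-cut
# `ReachDirZero₀` (append-only successor of …NatDirZeroDefs p527850), with the inclusions DIR₀₀ ⊆ DIR₀ and DIR₀₀ ⊆ TOWER₀

res-L1-w45b-lead-2 g2 (lead). OURS; planning vocabulary of the crux chain, not a statement of any manuscript; AI-written, weaker than expert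
review. WHY (lead's finding 2026-08-27T17:10Z, same ground as director-resolution RULING W4.5b NOSETOWER / GROTHENDIECK EXISTENCE 16:09:04Z):
the registered rung-v8 predicate `ReachDirZero` (res-L1-w45b-lead-2 g1 + res-type-027 DIRSTEP) admits direction steps over a carrier curve of ANY
genus (`DirStepSec` + `DirStepUnobs` carry no genus clause), while its upstairs supplier — res-type-027's T-P1VB (parts 1–13: `glued_A(a,b) = 𝒪(d)`
on `ℙ¹_A`, `Pic ℙ¹`, two-chart Čech) — is the PROJECTIVE-LINE case by construction (the DIRSTEP prose says «rational carrier», the typed text does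
not). Over a positive-genus carrier the lift of the section needs Grothendieck existence (F-88), which an unconditional W4.5b stub may not assume.
So the registered DIR₀ stub is re-cut to `ReachDirZero₀` := `ReachDirZero` ∧ «the reduced carrier curve `Z̃₉` is a projective line»
(`RationalCarrier (redSub F₉ Z₉ hZ₉)`, …NatTowerRationalDefs p547506); POSGENUS direction steps join the residue (POSGENUS-ROUND, F-88 path).
* `ReachDirZero₀` — the text of `ReachDirZero` VERBATIM with ONE extra conjunct `RationalCarrier (redSub F₉ Z₉ hZ₉)` before the `DirStep`-closure;
* `reachDirZero_of_reachDirZero₀` — DIR₀₀ ⊆ DIR₀ (drop the conjunct);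
* `reachTower₀_of_reachDirZero₀` — DIR₀₀ ⊆ TOWER₀ (…NatTowerOfDirZero p543612 re-run with the rational-carrier clause feeding `TowerRound₀`'s
  Čech disjunct): so HSUB′(ReachTower₀) ⊇ HSUB′(ReachDirZero₀)'s cases literally.
-/

set_option linter.dupNamespace false

noncomputable section

open CategoryTheory AlgebraicGeometry TopologicalSpace
open Literature.AlgebraicGeometry.Resolution (IsBlowup)

namespace Summit.ResolutionOfSingularities.ResolutionOfSingularities.Cruxes.EquisingularLiftNat.Sections

/-- **ReachDirZero₀** — rung v8 (DIR₀) re-cut to a RATIONAL carrier curve: `ReachDirZero`'s text verbatim (TC⁺ part + `DirStep`-closure) with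
the one extra conjunct `RationalCarrier (redSub F₉ Z₉ hZ₉)` (the reduced carrier curve is `≅ ℙ¹` over some field — T-P1VB's regime).
Downstairs only; K5′'s `Reach` slot. -/
def ReachDirZero₀ (F₁ F₂ : AlgebraicGeometry.Scheme.{0}) (υ : F₂ ⟶ F₁) (x : F₁) (T₂ : Set F₂)
    (F' : AlgebraicGeometry.Scheme.{0}) (β : F' ⟶ F₂) (T' : Set F') : Prop :=
  ∃ (W : Set F₁) (F₉ : AlgebraicGeometry.Scheme.{0}) (β₉ : F₉ ⟶ F₂) (T₉ Z₉ : Set F₉) (b₉ : Bool) (hZ₉ : IsClosed Z₉)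
    (F₁₀ : AlgebraicGeometry.Scheme.{0}) (υ' : F₁₀ ⟶ F₉) (γ' : F' ⟶ F₁₀) (E' : Set F'),
    ((x ∈ W) ∧ (¬ (υ ⁻¹' {x} ⊆ closure (υ ⁻¹' (W \ {x})))) ∧ ((∃ U : F₁.affineOpens, x ∈ (U : F₁.Opens) ∧ ((AlgebraicGeometry.Scheme.IdealSheafData.vanishingIdeal (⟨closure W, isClosed_closure⟩ : TopologicalSpace.Closeds F₁)).ideal U).IsPrincipal)) ∧ ((υ ⁻¹' {x} ∩ closure (υ ⁻¹' (W \ {x}))) ⊆ T₂) ∧ ((∀ R : (∀ G : AlgebraicGeometry.Scheme.{0}, (G ⟶ F₂) → Set G → Set G → Bool → Prop), R F₂ (CategoryTheory.CategoryStruct.id F₂) (T₂) (υ ⁻¹' {x} ∩ closure (υ ⁻¹' (W \ {x}))) false → (∀ (G₁ G₂ : AlgebraicGeometry.Scheme.{0}) (β : G₁ ⟶ F₂) (T Z : Set G₁) (b : Bool) (y : ↥((AlgebraicGeometry.Scheme.IdealSheafData.vanishingIdeal (⟨closure Z, isClosed_closure⟩ : TopologicalSpace.Closeds G₁))).subscheme)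 (υ₁ : G₂ ⟶ G₁) (hy : IsClosed ({(((AlgebraicGeometry.Scheme.IdealSheafData.vanishingIdeal (⟨closure Z, isClosed_closure⟩ : TopologicalSpace.Closeds G₁))).subschemeι y : G₁)} : Set G₁)), R G₁ β T Z b → (((AlgebraicGeometry.Scheme.IdealSheafData.vanishingIdeal (⟨closure Z, isClosed_closure⟩ : TopologicalSpace.Closeds G₁))).subschemeι y : G₁) ∈ T → IsRegularLocalRing (((AlgebraicGeometry.Scheme.IdealSheafData.vanishingIdeal (⟨closure Z, isClosed_closure⟩ : TopologicalSpace.Closeds G₁))).subscheme.presheaf.stalk y) → IsRegularLocalRing (G₁.presheaf.stalk (((AlgebraicGeometry.Scheme.IdealSheafData.vanishingIdeal (⟨closure Z, isClosed_closure⟩ : TopologicalSpace.Closeds G₁))).subschemeι y : G₁)) → Literature.AlgebraicGeometry.Resolution.IsBlowup υ₁ (AlgebraicGeometry.Scheme.IdealSheafData.vanishingIdeal (⟨{(((AlgebraicGeometry.Scheme.IdealSheafData.vanishingIdeal (⟨closure Z, isClosed_closure⟩ : TopologicalSpace.Closeds G₁))).subschemeι y : G₁)}, hy⟩ : TopologicalSpace.Closeds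 G₁)) → R G₂ (CategoryTheory.CategoryStruct.comp υ₁ β) (closure (υ₁ ⁻¹' (T \ {(((AlgebraicGeometry.Scheme.IdealSheafData.vanishingIdeal (⟨closure Z, isClosed_closure⟩ : TopologicalSpace.Closeds G₁))).subschemeι y : G₁)}))) (closure (υ₁ ⁻¹' (Z \ {(((AlgebraicGeometry.Scheme.IdealSheafData.vanishingIdeal (⟨closure Z, isClosed_closure⟩ : TopologicalSpace.Closeds G₁))).subschemeι y : G₁)}))) b) → (∀ (G₁ G₂ : AlgebraicGeometry.Scheme.{0}) (β : G₁ ⟶ F₂) (T Z : Set G₁) (y : ↥((AlgebraicGeometry.Scheme.IdealSheafData.vanishingIdeal (⟨closure Z, isClosed_closure⟩ : TopologicalSpace.Closeds G₁))).subscheme) (υ₁ : G₂ ⟶ G₁) (hy : IsClosed ({(((AlgebraicGeometry.Scheme.IdealSheafData.vanishingIdeal (⟨closure Z, isClosed_closure⟩ : TopologicalSpace.Closeds G₁))).subschemeι y : G₁)} : Set G₁)), R G₁ β T Z false → (((AlgebraicGeometry.Scheme.IdealSheafData.vanishingIdeal (⟨closure Z, isClosed_closure⟩ : TopologicalSpace.Closeds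 G₁))).subschemeι y : G₁) ∈ T → ¬ IsRegularLocalRing (((AlgebraicGeometry.Scheme.IdealSheafData.vanishingIdeal (⟨closure Z, isClosed_closure⟩ : TopologicalSpace.Closeds G₁))).subscheme.presheaf.stalk y) → IsRegularLocalRing (G₁.presheaf.stalk (((AlgebraicGeometry.Scheme.IdealSheafData.vanishingIdeal (⟨closure Z, isClosed_closure⟩ : TopologicalSpace.Closeds G₁))).subschemeι y : G₁)) → Literature.AlgebraicGeometry.Resolution.IsBlowup υ₁ (AlgebraicGeometry.Scheme.IdealSheafData.vanishingIdeal (⟨{(((AlgebraicGeometry.Scheme.IdealSheafData.vanishingIdeal (⟨closure Z, isClosed_closure⟩ : TopologicalSpace.Closeds G₁))).subschemeι y : G₁)}, hy⟩ : TopologicalSpace.Closeds G₁)) → R G₂ (CategoryTheory.CategoryStruct.comp υ₁ β) (closure (υ₁ ⁻¹' (T \ {(((AlgebraicGeometry.Scheme.IdealSheafData.vanishingIdeal (⟨closure Z, isClosed_closure⟩ : TopologicalSpace.Closeds G₁))).subschemeι y : G₁)}))) (closure (υ₁ ⁻¹' (Z \ {(((AlgebraicGeometry.Scheme.IdealSheafData.vanishingIdeal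 (⟨closure Z, isClosed_closure⟩ : TopologicalSpace.Closeds G₁))).subschemeι y : G₁)}))) true) → R F₉ β₉ T₉ Z₉ b₉)) ∧ (Z₉ ⊆ T₉) ∧ (¬ (T₉ ⊆ Z₉)) ∧ (Set.Finite {z : ↥((AlgebraicGeometry.Scheme.IdealSheafData.vanishingIdeal (⟨Z₉, hZ₉⟩ : TopologicalSpace.Closeds F₉))).subscheme | ¬ IsRegularLocalRing (((AlgebraicGeometry.Scheme.IdealSheafData.vanishingIdeal (⟨Z₉, hZ₉⟩ : TopologicalSpace.Closeds F₉))).subscheme.presheaf.stalk z)}) ∧ (Literature.AlgebraicGeometry.Resolution.IsBlowup υ' (AlgebraicGeometry.Scheme.IdealSheafData.vanishingIdeal (⟨Z₉, hZ₉⟩ : TopologicalSpace.Closeds F₉)))) ∧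
    RationalCarrier (redSub F₉ Z₉ hZ₉) ∧
    (∀ R₁ : (∀ G : AlgebraicGeometry.Scheme.{0}, (G ⟶ F₁₀) → Set G → Set G → Prop),
      R₁ F₁₀ (𝟙 F₁₀) (closure (υ' ⁻¹' (T₉ \ Z₉))) (υ' ⁻¹' Z₉) → DirStep F₉ F₁₀ υ' Z₉ hZ₉ R₁ → R₁ F' γ' T' E') ∧
    β = (γ' ≫ υ') ≫ β₉

/-- DIR₀₀ ⊆ DIR₀: a rational-carrier DIR₀ chain is a DIR₀ chain. [OURS · pure logic] -/
theorem reachDirZero_of_reachDirZero₀ (F₁ F₂ : Scheme.{0}) (υ : F₂ ⟶ F₁) (x : F₁) (T₂ : Set F₂) (F' : Scheme.{0}) (β : F' ⟶ F₂)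
    (T' : Set F') (h : ReachDirZero₀ F₁ F₂ υ x T₂ F' β T') : ReachDirZero F₁ F₂ υ x T₂ F' β T' := by
  obtain ⟨W, F₉, β₉, T₉, Z₉, b₉, hZ₉, F₁₀, υ', γ', E', htc, -, hdir, hβ⟩ := h
  exact ⟨W, F₉, β₉, T₉, Z₉, b₉, hZ₉, F₁₀, υ', γ', E', htc, hdir, hβ⟩

/-- **DIR₀₀ ⊆ TOWER₀**: every rational-carrier DIR₀ chain is a `ReachTower₀` chain (the cone shadow carried along by `exists_inCarrierReachK`,
each `DirStep` round a `TowerRound₀` through the Čech disjunct with the rational-carrier clause). [OURS · pure logic] -/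
theorem reachTower₀_of_reachDirZero₀ (F₁ F₂ : Scheme.{0}) (υ : F₂ ⟶ F₁) (x : F₁) (T₂ : Set F₂) (F' : Scheme.{0}) (β : F' ⟶ F₂)
    (T' : Set F') (h : ReachDirZero₀ F₁ F₂ υ x T₂ F' β T') : ReachTower₀ F₁ F₂ υ x T₂ F' β T' := by
  obtain ⟨W, F₉, β₉, T₉, Z₉, b₉, hZ₉, F₁₀, υ', γ', E', ⟨hxW, hnot, hWpr, hZT, hinner, hZ₉T₉, hT₉Z₉, hfin, hυ'⟩, hrat, hdir, hβ⟩ := h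
  obtain ⟨K₉, hK₉⟩ := exists_inCarrierReachK F₂ T₂ (υ ⁻¹' {x} ∩ closure (υ ⁻¹' (W \ {x}))) (closure (υ ⁻¹' (W \ {x})))
    F₉ β₉ T₉ Z₉ b₉ hinner
  let ReachT : ∀ G : Scheme.{0}, (G ⟶ F₁₀) → Set G → Set G → Set G → Prop := fun G γ T E K =>
    ∀ R₁ : (∀ G : Scheme.{0}, (G ⟶ F₁₀) → Set G → Set G → Set G → Prop),
      R₁ F₁₀ (𝟙 F₁₀) (closure (υ' ⁻¹' (T₉ \ Z₉))) (υ' ⁻¹' Z₉) (closure (υ' ⁻¹' (K₉ \ Z₉))) →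
      TowerPtReg F₁₀ R₁ → TowerPtRam F₁₀ R₁ → TowerRound₀ F₉ F₁₀ υ' Z₉ hZ₉ R₁ → R₁ G γ T E K
  have hreach : ∃ K' : Set F', ReachT F' γ' T' E' K' := by
    refine hdir (fun G γ T E => ∃ K : Set G, ReachT G γ T E K) ⟨closure (υ' ⁻¹' (K₉ \ Z₉)), fun R₁ hseed _ _ _ => hseed⟩ ?_
    intro G G'' γ T E hE Γ hΓ υ₂ ⟨K, hK⟩ hΓET hΓirr hsec hGreg hEreg hunobs hυ₂
    have hstep : ∀ R₁ : (∀ G : Scheme.{0}, (G ⟶ F₁₀) → Set G → Set G → Set G → Prop),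
        R₁ F₁₀ (𝟙 F₁₀) (closure (υ' ⁻¹' (T₉ \ Z₉))) (υ' ⁻¹' Z₉) (closure (υ' ⁻¹' (K₉ \ Z₉))) →
        TowerPtReg F₁₀ R₁ → TowerPtRam F₁₀ R₁ → TowerRound₀ F₉ F₁₀ υ' Z₉ hZ₉ R₁ →
        R₁ G'' (υ₂ ≫ γ) (closure (υ₂ ⁻¹' (T \ Γ))) (υ₂ ⁻¹' Γ) (closure (υ₂ ⁻¹' (K \ Γ))) ∧
          R₁ G'' (υ₂ ≫ γ) (closure (υ₂ ⁻¹' (T \ Γ))) (closure (υ₂ ⁻¹' (E \ Γ))) (closure (υ₂ ⁻¹' (K \ Γ))) := by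
      intro R₁ hseed hreg hram hround
      have hfull : TowerFull F₉ F₁₀ υ' Z₉ hZ₉ G γ Γ hΓ := by
        obtain ⟨δ, hδ, hiso⟩ := hsec
        exact ⟨δ, hδ, inferInstance, inferInstance, δ.surjective⟩
      exact hround G G'' γ T E K hE Γ hΓ υ₂ (hK R₁ hseed hreg hram hround) hΓET hΓirr.nonempty hfull
        (Or.inl ⟨hrat, hGreg, hEreg, hunobs⟩) hυ₂
    exact ⟨⟨closure (υ₂ ⁻¹' (K \ Γ)), fun R₁ hseed hreg hram hround => (hstep R₁ hseed hreg hram hround).1⟩,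
      ⟨closure (υ₂ ⁻¹' (K \ Γ)), fun R₁ hseed hreg hram hround => (hstep R₁ hseed hreg hram hround).2⟩⟩
  obtain ⟨K', hK'⟩ := hreach
  exact ⟨W, F₉, β₉, T₉, Z₉, K₉, b₉, hZ₉, F₁₀, υ', γ', E', K', hxW, hnot, hWpr, hZT, hK₉, hZ₉T₉, hT₉Z₉, hfin, hυ', hK', hβ⟩

end Summit.ResolutionOfSingularities.ResolutionOfSingularities.Cruxes.EquisingularLiftNat.Sections

end
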